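import Mathlib
import HarnessLib

/-!
# Line `Sketch` for the crux `ChiralDescent` (stmt-QuantumFields-17527) — stub `stub_vitaliOfMontel`

Crux: `Summit.QuantumFields.QCD.Theses.SpectralDefectExtinction.ChiralDescent`, item
stmt-QuantumFields-17527; skeleton `Cruxes/ChiralDescent/Lines/Sketch.lean`, stub W3b.

**Vitali–Porter from Montel on a disc.** The registered stub takes Montel's theorem for uniformly
bounded holomorphic sequences on discs as its first hypothesis (the neighbouring stub W3a) and
concludes: a uniformly bounded sequence `F k` of holomorphic functions on the disc `ball z₀ r`
which converges pointwise frequently near a point `w` of the disc (i.e. on a set accumulating at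
`w`) converges locally uniformly on the whole disc to a holomorphic limit `G`.

Proof (classical; G. Vitali 1903 / M. B. Porter 1904; Titchmarsh, *The Theory of Functions*,
§5.21; Conway, *Functions of One Complex Variable I*, VII Exercise 2.4), pure Mathlib:

* `subseq_limits_eq_of_tendsto` — two locally uniform limits of subsequences agree at every point
  where the full sequence converges (uniqueness of limits in `ℂ`);
* `eqOn_ball_of_subseq_limits` — hence, by the identity theorem
  (`AnalyticOnNhd.eqOn_of_preconnected_of_frequently_eq` on the preconnected open disc), any two
  holomorphic subsequential limits agree on the disc;
* `stub_vitaliOfMontel` — the subsequence principle: take the Montel limit `G` of one subsequence;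
  if `F` failed to converge uniformly to `G` on some compact `K ⊆ ball z₀ r`, a bad subsequence
  stays `ε`-away from `G` somewhere on `K`; Montel extracts a convergent sub-subsequence whose limit
  is again `G` by the previous step — contradiction.

The argument is adapted from the tree file `Literature/Analysis/Complex/VitaliConvergence.lean`
(`Literature.Analysis.Complex.exists_tendstoLocallyUniformlyOn_of_unique_limits` and
`eqOn_of_subseq_limits_of_frequently_tendsto`), specialised to a disc and with Montel's theorem
taken as a hypothesis instead of imported, exactly as the skeleton registers it.
No definitions, nothing conditional, no citations needed (folklore).
-/

namespace Summit.QuantumFields.QCD.Cruxes.ChiralDescent.InfimumDescent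

open Filter Topology

/-- Two locally uniform limits `G`, `G'` of subsequences `F ∘ ψ`, `F ∘ ψ'` agree at every point of
the set of convergence `s` where the full sequence `F · z` converges. [folklore] -/
theorem subseq_limits_eq_of_tendsto {F : ℕ → ℂ → ℂ} {s : Set ℂ} {G G' : ℂ → ℂ} {ψ ψ' : ℕ → ℕ}
    (hψ : StrictMono ψ) (hψ' : StrictMono ψ')
    (hlim : TendstoLocallyUniformlyOn (fun n => F (ψ n)) G atTop s)
    (hlim' : TendstoLocallyUniformlyOn (fun n => F (ψ' n)) G' atTop s) {z : ℂ} (hz : z ∈ s)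
    {c : ℂ} (hc : Tendsto (fun n => F n z) atTop (𝓝 c)) : G z = G' z := by
  -- adapted from Literature/Analysis/Complex/VitaliConvergence.lean (subseq_limits_eq_of_tendsto)
  have h1 : Tendsto (fun n => F (ψ n) z) atTop (𝓝 (G z)) := hlim.tendsto_at hz
  have h2 : Tendsto (fun n => F (ψ' n) z) atTop (𝓝 (G' z)) := hlim'.tendsto_at hz
  have h1' : Tendsto (fun n => F (ψ n) z) atTop (𝓝 c) := hc.comp hψ.tendsto_atTop
  have h2' : Tendsto (fun n => F (ψ' n) z) atTop (𝓝 c) := hc.comp hψ'.tendsto_atTop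
  rw [tendsto_nhds_unique h1 h1', tendsto_nhds_unique h2 h2']

/-- **Identity-theorem step.** On a disc, if the sequence `F` converges pointwise frequently near a
point `w` of the disc, then any two holomorphic locally uniform limits of subsequences of `F` agree
on the whole disc (the disc is open and preconnected, and the two limits agree on a set
accumulating at `w`). [folklore] -/
theorem eqOn_ball_of_subseq_limits {F : ℕ → ℂ → ℂ} {z₀ : ℂ} {r : ℝ} {w : ℂ}
    (hw : w ∈ Metric.ball z₀ r)
    (hS : ∃ᶠ z in 𝓝[≠] w, ∃ l : ℂ, Tendsto (fun k => F k z) atTop (𝓝 l))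
    {G G' : ℂ → ℂ} (hG : DifferentiableOn ℂ G (Metric.ball z₀ r))
    (hG' : DifferentiableOn ℂ G' (Metric.ball z₀ r)) {ψ ψ' : ℕ → ℕ}
    (hψ : StrictMono ψ) (hψ' : StrictMono ψ')
    (hlim : TendstoLocallyUniformlyOn (fun n => F (ψ n)) G atTop (Metric.ball z₀ r))
    (hlim' : TendstoLocallyUniformlyOn (fun n => F (ψ' n)) G' atTop (Metric.ball z₀ r)) :
    Set.EqOn G G' (Metric.ball z₀ r) := by
  -- adapted from Literature/Analysis/Complex/VitaliConvergence.lean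
  -- (eqOn_of_subseq_limits_of_frequently_tendsto)
  have hfa : AnalyticOnNhd ℂ G (Metric.ball z₀ r) := hG.analyticOnNhd Metric.isOpen_ball
  have hfa' : AnalyticOnNhd ℂ G' (Metric.ball z₀ r) := hG'.analyticOnNhd Metric.isOpen_ball
  have hfreq : ∃ᶠ z in 𝓝[≠] w, G z = G' z := by
    have hev : ∀ᶠ z in 𝓝[≠] w, z ∈ Metric.ball z₀ r :=
      mem_nhdsWithin_of_mem_nhds (Metric.isOpen_ball.mem_nhds hw)
    refine (hS.and_eventually hev).mono fun z hz => ?_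
    obtain ⟨⟨c, hc⟩, hzU⟩ := hz
    exact subseq_limits_eq_of_tendsto hψ hψ' hlim hlim' hzU hc
  exact hfa.eqOn_of_preconnected_of_frequently_eq hfa' (convex_ball z₀ r).isPreconnected hw hfreq

/-- **Stub W3b — Vitali–Porter from Montel on a disc.** Assume Montel's theorem for uniformly
bounded holomorphic sequences on discs (first hypothesis). Then a uniformly bounded sequence of
holomorphic functions on `ball z₀ r` which converges pointwise on a set accumulating at a point
`w` of the disc converges locally uniformly on the disc to a holomorphic function. (Subsequence
principle: the Montel limit `G` of one subsequence is the only possible subsequential limit by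
`eqOn_ball_of_subseq_limits`, so the whole sequence converges to it uniformly on every compact
subset of the disc.) [folklore] -/
theorem stub_vitaliOfMontel :
    (∀ (F : ℕ → ℂ → ℂ) (z₀ : ℂ) (r M : ℝ),
      (∀ k, DifferentiableOn ℂ (F k) (Metric.ball z₀ r)) →
      (∀ k, ∀ z ∈ Metric.ball z₀ r, ‖F k z‖ ≤ M) →
      ∃ φ : ℕ → ℕ, StrictMono φ ∧ ∃ G : ℂ → ℂ, DifferentiableOn ℂ G (Metric.ball z₀ r) ∧
        TendstoLocallyUniformlyOn (fun k => F (φ k)) G atTop (Metric.ball z₀ r)) →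
    ∀ (F : ℕ → ℂ → ℂ) (z₀ : ℂ) (r M : ℝ),
      (∀ k, DifferentiableOn ℂ (F k) (Metric.ball z₀ r)) →
      (∀ k, ∀ z ∈ Metric.ball z₀ r, ‖F k z‖ ≤ M) →
      (∃ w ∈ Metric.ball z₀ r, ∃ᶠ z in 𝓝[≠] w, ∃ l : ℂ, Tendsto (fun k => F k z) atTop (𝓝 l)) →
      ∃ G : ℂ → ℂ, DifferentiableOn ℂ G (Metric.ball z₀ r) ∧
        TendstoLocallyUniformlyOn F G atTop (Metric.ball z₀ r) := by
  -- adapted from Literature/Analysis/Complex/VitaliConvergence.lean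
  -- (exists_tendstoLocallyUniformlyOn_of_unique_limits), with Montel as the hypothesis `hMontel`
  intro hMontel F z₀ r M hd hb hacc
  obtain ⟨w, hw, hS⟩ := hacc
  -- Montel applied to the full sequence: one subsequential limit `G`, holomorphic on the disc
  obtain ⟨φ, hφ, G, hGd, hlim⟩ := hMontel F z₀ r M hd hb
  refine ⟨G, hGd, ?_⟩
  rw [tendstoLocallyUniformlyOn_iff_forall_isCompact Metric.isOpen_ball]
  intro K hKU hK
  by_contra hnot
  rw [Metric.tendstoUniformlyOn_iff] at hnot
  push Not at hnot
  obtain ⟨ε, hε, hfreq⟩ := hnot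
  -- a bad subsequence `F ∘ ψ`, `ε`-away from `G` somewhere on `K` at every index
  obtain ⟨ψ, hψ, hbad⟩ := extraction_of_frequently_atTop hfreq
  -- Montel applied to the bad subsequence: a convergent sub-subsequence with limit `G'`
  obtain ⟨χ, hχ, G', hG'd, hlim'⟩ :=
    hMontel (fun n => F (ψ n)) z₀ r M (fun n => hd (ψ n)) (fun n => hb (ψ n))
  -- the identity theorem identifies `G' = G` on the disc
  have heq : Set.EqOn G G' (Metric.ball z₀ r) :=
    eqOn_ball_of_subseq_limits hw hS hGd hG'd hφ (hψ.comp hχ) hlim hlim'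
  -- so `F ∘ ψ ∘ χ → G` uniformly on `K`, contradicting badness
  have hK' := (tendstoLocallyUniformlyOn_iff_forall_isCompact Metric.isOpen_ball).1 hlim' K hKU hK
  rw [Metric.tendstoUniformlyOn_iff] at hK'
  obtain ⟨N, hN⟩ := eventually_atTop.1 (hK' ε hε)
  obtain ⟨x, hxK, hx⟩ := hbad (χ N)
  have h1 : dist (G' x) (F (ψ (χ N)) x) < ε := hN N le_rfl x hxK
  rw [← heq (hKU hxK)] at h1
  exact absurd h1 (not_lt.2 hx)

end Summit.QuantumFields.QCD.Cruxes.ChiralDescent.InfimumDescent
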